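/-
Copyright (c) 2026 the pub-hodgecm-mathlib formalisation cell (harness21).  Prover seat hodgecm-mathlib-LH4-p06 (g5), Track A «(D-RAM) FOUR-FRAME», unit U2H, census leaf
(ρ2b′-X) `stub_U2H_fixedPointCensus_typeTwo_unit0` — T5c «TORIC LEVEL CENSUS, M∕E-RAMIFIED»: the TOP CELLS of the depth-refined census (payer LH4-p14 (g4) MAP v2 seam
S6-RM, sheet v5 (D3) «diagonal sign cells») — PREPARATORY LEMMAS, the RamM twin of LH4-p08 (g4)'s type-U ★ `F0P3cDyRamToricLevelCensusUnrTopPrep` over ★ p857535 (g4's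
RamM depth rows).  2026-09-04.
-/
import Summits.HodgeConjecture.HodgeConjecture.Theorems.F0P3cDyRamToricLevelCensusRamMDep      -- ★ p857535 (LH4-p06 (g4)): `dep_iff_of_witness_ramified`, `v_depthUnit_sub_map_eq_ramified`, `v_sub_map_le_mul_exp_of_level`; brings ★ HEAD p857549 + ★ RamM organs
import Summits.HodgeConjecture.HodgeConjecture.Theorems.F0P3cDyRamToricLevelCensusUnrTopPrep   -- ★ p857519 (LH4-p08 (g4)): the TYPE-FREE `v_twist_add_eq` (and, for the sequel, `setOf_v_one_add_mul_twist_le_eq_smul_of_le`)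
import HarnessLib

/-!
# T5c: the TOP CELLS of the depth-refined level census `levelSetDep`, M∕E-RAMIFIED frame — preparatory lemmas (sheet v5 (D3): the diagonal sign cells)

Cell `hodgecm-mathlib` (D-0151), FLOOR 0, crux H413 = `stmt-HodgeConjecture-24833`; squad F0∕P3c∕LH4; lane `--supports stmt-HodgeConjecture-24833 --as helper` (count-neutral).
THEOREMS ONLY (no `def`, no instance, no notation, no `sorry`, default heartbeats).  Socket served: payer MAP v2 seam S6-RM — «top cells (D3) open for p06's heir»: the one row
of the type-RamM table `#levelSetDep(j, a; μ)` that ★ p857535 (`levelSetDep_eq_of_generic_ramified`: off the coincidence diagonal ∕ under `GEN`) leaves open, namely the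
COINCIDENCE DIAGONAL `j + m = jλ + a` with `e := 2a − m ≥ 1` (⟺ `¬GEN` there).  This file proves the bookkeeping sentences; the count is the sequel `…RamMTop`.

TOKENS (ramified frame, as in ★ p857535): `(M, ρ, α, d_ρ)` a ★ ramified quadratic datum, `Θ` an isometric involution commuting with `ρ`, `ϖE` `ρ`-fixed with `|ϖE| = exp(−2)`,
`h ≠ 0`, `|h| = exp(−v_h)`; `|μ| = |ϖE|^m`, `|μ − ρμ| = |ϖE^{jλ}(α − ρα)|`; level `a`, tree level `j ≤ jλ`; level equation `v_h + d_ρ + 2k₀ + 2j = 2a` (generators `x₀ = α^{k₀}·ω`,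
★ p857372); `η := (ρh∕h)·t(α^{k₀})` the class twist, `κ := ρμ∕μ`, `t(ω) = ρN(ω)∕N(ω)`, `N(ω) = ωΘω`.
THE MECHANISM (all ★; step for step LH4-p08 (g4)'s T5a top-cell argument in doubled tokens with `d_ρ` carried):
* §1 `le_of_mu_tokens_ramified` (`m ≤ jλ`: the different bound on `μ`), `v_one_sub_twist_eq_ramified` (`|1 − κ| = exp(2m − 2jλ − d_ρ)`), **`dep_top_iff_ramified`** — on the
  top half (`a ≤ m < j + a`) the ★ depth clause of a generator is `|1 + (ρh∕h)∕κ · t(x₀)| ≤ exp(2m − 2a − 2j − d_ρ)`; **`v_one_add_twist_eq_of_top_ramified`** — on the diagonal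
  with `m < 2a` that inequality FORCES the level clause `|1 + η·τ| = exp(2a − 2j − d_ρ)` (`1 + ητ = κ(1 + (η∕κ)τ) + (1 − κ)`, strict ultrametric).
* §2 `ncard_levelSetDep_eq_ncard_image_mk_ramified` — `#levelSetDep` as generator classes mod `H = 𝒪_jˣ` (★ F1 + ★ `dep_iff_of_witness_ramified`); the empty rows
  `levelSet(Dep)_eq_empty_of_forall_ne_ramified` (no solution of the level equation — e.g. `v_h + d_ρ` odd — carries no lattice at all).
HONEST LABEL.  Count-neutral (`--supports`); unconditional algebra over ★ organs; the census LAW (ρ2b′-X) is NOT asserted — `HC_CM` is proved only modulo the 7 printed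
citations (2 remaining named inputs: hLiu418 = `stmt-HodgeConjecture-24832`, h413 = `stmt-HodgeConjecture-24833`) until rung 0 closes.

## References
* [Jacobowitz1962] R. Jacobowitz, *Hermitian forms over local fields*, Amer. J. Math. 84 (1962): §4 (duals, modular lattices, norm classes).
* [Serre1979] J.-P. Serre, *Local Fields*, GTM 67 (1979): Ch. IV §1 Prop. 3–4; Ch. V §1, §3 (norm subgroups, Cor. 3).
* [Kottwitz1986BaseChangeUnits] R. E. Kottwitz, *Base change for unit elements of Hecke algebras*, Compositio Math. 60 (1986): §1 pp. 240–241 (the tube ∕ depth condition).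
* [Flicker1998UnitaryFL] Y. Z. Flicker, *Elementary proof of the fundamental lemma for a unitary group*, Canad. J. Math. 50 (1998): Prop. 7 p. 84 (Mars' unit indices).
-/

set_option autoImplicit false

noncomputable section

namespace Summit.HodgeConjecture.HodgeConjecture.Cruxes.H413.F0P3cDyRamToricLevelCensusRamM

open WithZero
open scoped Pointwise Valued
open Literature.NumberTheory.Automorphic.UnitaryThreeFourFrame (IsRamifiedQuadraticDatum)
open Literature.NumberTheory.LocalFields.QuadraticOrder
open Summit.HodgeConjecture.HodgeConjecture.Cruxes.H413.F0P3cDyRamToricCensusDefs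
open Summit.HodgeConjecture.HodgeConjecture.Cruxes.H413.F0P3cDyRamToricLevelCensusUnr (v_twist_add_eq)

variable {K : Type} [Field K] [Valued K ℤᵐ⁰] {ρ Θ : K →+* K} {α ϖE h : K} {dρ t : ℕ}

/-! ## §1 Bookkeeping on the top diagonal (ramified tokens) -/

/-- **`m ≤ jλ`**: the different bound `|μ − ρμ| ≤ |μ|·exp(−d_ρ)` (★ `v_sub_map_le_mul_exp_of_level`) read on the tokens `|μ| = |ϖE|^m`, `|μ − ρμ| = |ϖE^{jλ}(α − ρα)|`
(so on the diagonal `j + m = jλ + a` every occupied level has `a ≤ j`). [cite: Serre1979, Ch. IV §1 Prop. 3–4] -/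
theorem le_of_mu_tokens_ramified (hD : IsRamifiedQuadraticDatum ρ α dρ t) (hρϖ : ρ ϖE = ϖE) (hϖE : Valued.v ϖE = exp (-2 : ℤ))
    {μ : K} {m jl : ℕ} (hμ : Valued.v μ = Valued.v ϖE ^ m) (hjl : Valued.v (μ - ρ μ) = Valued.v (ϖE ^ jl * (α - ρ α))) : m ≤ jl := by
  have hb := v_sub_map_le_mul_exp_of_level hD hρϖ hϖE hμ
  rw [hjl, map_mul, map_pow, v_sub_map_eq_exp_of_datum hD, hμ, v_varpiE_pow hϖE, v_varpiE_pow hϖE, ← exp_add, ← exp_add,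
    exp_le_exp] at hb
  omega

/-- **`|1 − κ| = exp(2m − 2jλ − d_ρ)`** for `κ = ρμ∕μ` (`1 − κ = (μ − ρμ)∕μ`). [cite: Serre1979, Ch. V §3] -/
theorem v_one_sub_twist_eq_ramified (hD : IsRamifiedQuadraticDatum ρ α dρ t) (hϖE : Valued.v ϖE = exp (-2 : ℤ))
    {μ : K} {m jl : ℕ} (hμ : Valued.v μ = Valued.v ϖE ^ m) (hjl : Valued.v (μ - ρ μ) = Valued.v (ϖE ^ jl * (α - ρ α))) :
    Valued.v (1 - ρ μ / μ) = exp (2 * (m : ℤ) - 2 * jl - dρ) := by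
  have hμ0 : μ ≠ 0 := fun h0 => by
    rw [h0, map_zero, v_varpiE_pow hϖE] at hμ; exact exp_ne_zero hμ.symm
  rw [one_sub_div hμ0, map_div₀, hjl, map_mul, map_pow, v_sub_map_eq_exp_of_datum hD, hμ, v_varpiE_pow hϖE, v_varpiE_pow hϖE,
    ← exp_add, ← exp_sub]
  congr 1; ring

/-- **TOP-CELL FORM OF THE DEPTH CONDITION (RamM).**  On the top half of the table (`a ≤ m < j + a`) the ★ `dep_iff_of_witness_ramified` clause for a generator `x₀` of
level `|y| = |ϖE|^a` is `|1 + ((ρh∕h)∕κ)·t(x₀)| ≤ exp(2m − 2a − 2j − d_ρ)` (`κ = ρμ∕μ`, `t(x₀) = ρN(x₀)∕N(x₀)`; ★ `v_depthUnit_sub_map_eq_ramified`: `(1 + θ) + (κ − 1) =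
θ + κ = κ(1 + θ∕κ)`). [cite: Jacobowitz1962, §4] [cite: Kottwitz1986BaseChangeUnits, §1 pp. 240–241] -/
theorem dep_top_iff_ramified (hD : IsRamifiedQuadraticDatum ρ α dρ t) (hρϖ : ρ ϖE = ϖE) (hϖE : Valued.v ϖE = exp (-2 : ℤ)) (hh : h ≠ 0)
    {μ : K} {m jl : ℕ} (hμ : Valued.v μ = Valued.v ϖE ^ m) (hjl : Valued.v (μ - ρ μ) = Valued.v (ϖE ^ jl * (α - ρ α)))
    {j a : ℕ} (ham : a ≤ m) (hma : m < j + a) {x₀ : K} (hx₀ : x₀ ≠ 0)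
    (hya : Valued.v (h * (x₀ * Θ x₀) * (ϖE ^ j * (α - ρ α))) = Valued.v ϖE ^ a) :
    (a ≤ m ∧ (j + a ≤ m ∨
        Valued.v (μ / (h * (x₀ * Θ x₀) * (ϖE ^ j * (α - ρ α)) * ϖE ^ (m - a)) - ρ (μ / (h * (x₀ * Θ x₀) * (ϖE ^ j * (α - ρ α)) * ϖE ^ (m - a)))) ≤
          exp (2 * (m : ℤ) - 2 * a - 2 * j - dρ))) ↔
      Valued.v (1 + ρ h / h / (ρ μ / μ) * (ρ (x₀ * Θ x₀) / (x₀ * Θ x₀))) ≤ exp (2 * (m : ℤ) - 2 * a - 2 * j - dρ) := by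
  -- adapted from LH4-p08 (g4)'s type-U `dep_top_iff` (★ F0P3cDyRamToricLevelCensusUnrTopPrep)
  obtain ⟨-, hvρ, -, -, -, -, -⟩ := id hD
  have hμ0 : μ ≠ 0 := fun h0 => by
    rw [h0, map_zero, v_varpiE_pow hϖE] at hμ; exact exp_ne_zero hμ.symm
  have hκ : Valued.v (ρ μ / μ) = 1 := by rw [map_div₀, hvρ, div_self ((Valuation.ne_zero_iff _).2 hμ0)]
  obtain ⟨hz, -⟩ := v_depthUnit_sub_map_eq_ramified hD hρϖ hϖE hh hμ hjl ham hx₀ hya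
  have hring : (1 + ρ h / h * (ρ (x₀ * Θ x₀) / (x₀ * Θ x₀))) + (ρ μ / μ - 1) = ρ h / h * (ρ (x₀ * Θ x₀) / (x₀ * Θ x₀)) + ρ μ / μ := by
    ring
  rw [hz, hring, v_twist_add_eq _ _ hκ]
  constructor
  · rintro ⟨-, h1 | h2⟩
    · exfalso; omega
    · exact h2
  · exact fun h2 => ⟨ham, Or.inr h2⟩

/-- **THE LEVEL CLAUSE IS AUTOMATIC ON A TOP SOLUTION (RamM)**: on the diagonal `j + m = jλ + a` (`|1 − κ| = exp(2a − 2j − d_ρ)`) with `m < 2a`, if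
`|1 + (η∕κ)·τ| ≤ exp(2m − 2a − 2j − d_ρ)` then `|1 + η·τ| = exp(2a − 2j − d_ρ)` (`1 + ητ = κ(1 + (η∕κ)τ) + (1 − κ)`, strict ultrametric inequality). [cite: Serre1979, Ch. V §3] -/
theorem v_one_add_twist_eq_of_top_ramified (hD : IsRamifiedQuadraticDatum ρ α dρ t) (hϖE : Valued.v ϖE = exp (-2 : ℤ))
    {μ : K} {m jl : ℕ} (hμ : Valued.v μ = Valued.v ϖE ^ m) (hjl : Valued.v (μ - ρ μ) = Valued.v (ϖE ^ jl * (α - ρ α)))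
    {j a : ℕ} (hdiag : j + m = jl + a) (he : m < 2 * a) {η τ : K}
    (htop : Valued.v (1 + η / (ρ μ / μ) * τ) ≤ exp (2 * (m : ℤ) - 2 * a - 2 * j - dρ)) :
    Valued.v (1 + η * τ) = exp (2 * (a : ℤ) - 2 * j - dρ) := by
  -- adapted from LH4-p08 (g4)'s type-U `v_one_add_twist_eq_of_top` (★ F0P3cDyRamToricLevelCensusUnrTopPrep)
  obtain ⟨-, hvρ, -, -, -, -, -⟩ := id hD
  have hμ0 : μ ≠ 0 := fun h0 => by
    rw [h0, map_zero, v_varpiE_pow hϖE] at hμ; exact exp_ne_zero hμ.symm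
  have hρμ0 : ρ μ ≠ 0 := (map_ne_zero ρ).2 hμ0
  have hκ : Valued.v (ρ μ / μ) = 1 := by rw [map_div₀, hvρ, div_self ((Valuation.ne_zero_iff _).2 hμ0)]
  have h1κ : Valued.v (1 - ρ μ / μ) = exp (2 * (a : ℤ) - 2 * j - dρ) := by
    rw [v_one_sub_twist_eq_ramified hD hϖE hμ hjl]; congr 1; omega
  have hsplit : 1 + η * τ = ρ μ / μ * (1 + η / (ρ μ / μ) * τ) + (1 - ρ μ / μ) := by
    field_simp
    ring
  have hlt : Valued.v (ρ μ / μ * (1 + η / (ρ μ / μ) * τ)) < Valued.v (1 - ρ μ / μ) := by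
    rw [map_mul, hκ, one_mul, h1κ]
    exact htop.trans_lt (by rw [exp_lt_exp]; omega)
  rw [hsplit, Valuation.map_add_eq_of_lt_right _ hlt, h1κ]

/-! ## §2 `#levelSetDep` as generator classes; the empty rows -/

/-- **GENERATOR CLASSES OF `levelSetDep` (RamM)**: `#levelSetDep(j,a;μ) = #(mk_{𝒪_jˣ} '' {x₀ : integral ∧ Gram-primitive ∧ level a ∧ ★ depth clause(x₀)})`
(★ F1 `ncard_setOf_orderLattice_eq_ncard_image_mk` + ★ `dep_iff_of_witness_ramified`). [cite: Jacobowitz1962, §4] [cite: Flicker1998UnitaryFL, p. 84] -/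
theorem ncard_levelSetDep_eq_ncard_image_mk_ramified (hD : IsRamifiedQuadraticDatum ρ α dρ t) (hΘΘ : ∀ x, Θ (Θ x) = x)
    (hΘρ : ∀ x, Θ (ρ x) = ρ (Θ x)) (hvΘ : ∀ x, Valued.v (Θ x) = Valued.v x) (hρϖ : ρ ϖE = ϖE) (hϖE : Valued.v ϖE = exp (-2 : ℤ)) (hh : h ≠ 0)
    {μ : K} {m : ℕ} (hμ : Valued.v μ = Valued.v ϖE ^ m) {H : Subgroup Kˣ} (j a : ℕ)
    (hH : ∀ u : Kˣ, u ∈ H ↔ Valued.v (u : K) = 1 ∧ Valued.v ((u : K) - ρ u) ≤ Valued.v (ϖE ^ j * (α - ρ α))) :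
    (levelSetDep ρ Θ α ϖE h j a μ).ncard =
      ((QuotientGroup.mk : Kˣ → Kˣ ⧸ H) '' {x₀ : Kˣ |
        (((Valued.v (h * ((x₀ : K) * Θ x₀) * (ϖE ^ j * (α - ρ α))) ≤ 1 ∧
              Valued.v (h * ((x₀ : K) * Θ x₀) * (ϖE ^ j * (α - ρ α)) - ρ (h * ((x₀ : K) * Θ x₀) * (ϖE ^ j * (α - ρ α)))) ≤ Valued.v (ϖE ^ j * (α - ρ α))) ∧
            ¬ (Valued.v (h * ((x₀ : K) * Θ x₀) * (ϖE ^ j * (α - ρ α)) / ϖE) ≤ 1 ∧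
                Valued.v (h * ((x₀ : K) * Θ x₀) * (ϖE ^ j * (α - ρ α)) / ϖE - ρ (h * ((x₀ : K) * Θ x₀) * (ϖE ^ j * (α - ρ α)) / ϖE)) ≤
                  Valued.v (ϖE ^ j * (α - ρ α)))) ∧
          Valued.v (h * ((x₀ : K) * Θ x₀) * (ϖE ^ j * (α - ρ α))) = Valued.v ϖE ^ a) ∧
        (a ≤ m ∧ (j + a ≤ m ∨
          Valued.v (μ / (h * ((x₀ : K) * Θ x₀) * (ϖE ^ j * (α - ρ α)) * ϖE ^ (m - a)) -
              ρ (μ / (h * ((x₀ : K) * Θ x₀) * (ϖE ^ j * (α - ρ α)) * ϖE ^ (m - a)))) ≤ exp (2 * (m : ℤ) - 2 * a - 2 * j - dρ)))}).ncard := by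
  -- adapted from LH4-p08 (g4)'s type-U `ncard_levelSetDep_eq_ncard_image_mk` (★ F0P3cDyRamToricLevelCensusUnrTopPrep)
  obtain ⟨-, hvρ, -, -, -, -, -⟩ := id hD
  rw [← ncard_setOf_orderLattice_eq_ncard_image_mk hvρ hH]
  congr 1
  ext Λ
  constructor
  · rintro ⟨hL, hdep⟩
    obtain ⟨x₀, hx₀, hΛx, hyO, hyN, hya⟩ := hL
    have hQ := (dep_iff_of_witness_ramified hD hΘΘ hΘρ hvΘ hρϖ hϖE hh hμ hx₀ hΛx hya).1 hdep
    simp only [IsOrd, dualGen] at hyO hyN hya hQ hΛx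
    exact ⟨Units.mk0 x₀ hx₀, ⟨⟨⟨hyO, hyN⟩, hya⟩, hQ⟩, hΛx⟩
  · rintro ⟨x₀, ⟨⟨⟨hyO, hyN⟩, hya⟩, hQ⟩, hΛx⟩
    have hΛx' : ∀ x, x ∈ Λ ↔ ∃ z, IsOrd ρ α (ϖE ^ j) z ∧ x = (x₀ : K) * z := hΛx
    have hya' : Valued.v (dualGen ρ Θ α (ϖE ^ j) h x₀) = Valued.v ϖE ^ a := hya
    refine ⟨⟨(x₀ : K), x₀.ne_zero, hΛx', hyO, hyN, hya'⟩, ?_⟩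
    exact (dep_iff_of_witness_ramified hD hΘΘ hΘρ hvΘ hρϖ hϖE hh hμ x₀.ne_zero hΛx' hya').2 hQ

/-- **NO SOLUTION OF THE LEVEL EQUATION: THE LEVEL SET IS EMPTY (RamM)** — if `v_h + d_ρ + 2k + 2j ≠ 2a` for every `k` (e.g. `v_h + d_ρ` odd: no level is ever occupied),
`levelSet(j,a) = ∅` (every generator is `α^k·ω`, ★ `v_hermGenR_zpow_mul`). [cite: Jacobowitz1962, §4] [cite: Flicker1998UnitaryFL, p. 84] -/
theorem levelSet_eq_empty_of_forall_ne_ramified (hD : IsRamifiedQuadraticDatum ρ α dρ t) (hvΘ : ∀ x, Valued.v (Θ x) = Valued.v x)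
    (hϖE : Valued.v ϖE = exp (-2 : ℤ)) {vh : ℤ} (hvh : Valued.v h = exp (-vh)) (j a : ℕ) (hne : ∀ k : ℤ, vh + dρ + 2 * k + 2 * j ≠ 2 * a) :
    levelSet ρ Θ α ϖE h j a = ∅ := by
  obtain ⟨-, -, hα, -, -, -, -⟩ := id hD
  ext Λ
  simp only [Set.mem_empty_iff_false, iff_false]
  rintro ⟨x₀, hx₀, -, -, -, hya⟩
  obtain ⟨k, ω, hω, hx⟩ := exists_eq_uniformizer_zpow_mul_unit hα hx₀
  simp only [dualGen] at hya
  rw [hx, v_hermGenR_zpow_mul (ρ := ρ) hvΘ hα (v_sub_map_eq_exp_of_datum hD) hϖE hvh j hω, v_varpiE_pow hϖE, exp_inj] at hya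
  exact hne k (by omega)

/-- **NO SOLUTION OF THE LEVEL EQUATION: NO DEPTH-REFINED LATTICE EITHER** (`levelSetDep ⊆ levelSet = ∅`). [cite: Jacobowitz1962, §4] -/
theorem levelSetDep_eq_empty_of_forall_ne_ramified (hD : IsRamifiedQuadraticDatum ρ α dρ t) (hvΘ : ∀ x, Valued.v (Θ x) = Valued.v x)
    (hϖE : Valued.v ϖE = exp (-2 : ℤ)) {vh : ℤ} (hvh : Valued.v h = exp (-vh)) (j a : ℕ) (hne : ∀ k : ℤ, vh + dρ + 2 * k + 2 * j ≠ 2 * a) (μ : K) :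
    levelSetDep ρ Θ α ϖE h j a μ = ∅ :=
  Set.subset_eq_empty (levelSetDep_subset ρ Θ α ϖE h j a μ) (levelSet_eq_empty_of_forall_ne_ramified hD hvΘ hϖE hvh j a hne)

end Summit.HodgeConjecture.HodgeConjecture.Cruxes.H413.F0P3cDyRamToricLevelCensusRamM

end
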